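import Mathlib
import Summits.Ventures.PercRepro2.PMK5Deg3Kernel
import Summits.Ventures.PercRepro2.PMK5Deg3LitsA1A2B

/-!
# The slice certificates of the triple `(a₁, a₂, b) = (1, 2, 4)`, part 3: the slices `(2, 0), (2, 1), (2, 2), (2, 3)`
(blind cell PercRepro2, mine-2 g27; `PMK5Deg3Kernel.lean`, literals `PMK5Deg3LitsA1A2B.lean`)

One `decide +kernel` per slice `(j₁, j₂)` of the profile digits of the `a₃`-edges `11`, `12`: `kNegS ≤ kPosS`,
`Nat.land (kPosS − kNegS) mask = 0`, `Nat.land kNegS mask = 0` on the `4^11`-digit slice numbers built from the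
table literals — every typed three-copy class sum of `K₃` on `K₅ + {a₃a₁, a₃a₂, a₃b}` with those two digits is `≥ 0`.
Census twin: kit j260972 (M2-63, two own codes, 0 negative class sums on every triple).
-/

namespace Summit.Ventures.PercRepro2

namespace Deg3

set_option maxHeartbeats 0 in
set_option maxRecDepth 100000 in
/-- The slice `(2, 0)` of the triple `(1, 2, 4)`. -/
theorem certS_a1a2b_20 : CertS La1a2b 2 0 := by
  unfold CertS
  decide +kernel

set_option maxHeartbeats 0 in
set_option maxRecDepth 100000 in
/-- The slice `(2, 1)` of the triple `(1, 2, 4)`. -/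
theorem certS_a1a2b_21 : CertS La1a2b 2 1 := by
  unfold CertS
  decide +kernel

set_option maxHeartbeats 0 in
set_option maxRecDepth 100000 in
/-- The slice `(2, 2)` of the triple `(1, 2, 4)`. -/
theorem certS_a1a2b_22 : CertS La1a2b 2 2 := by
  unfold CertS
  decide +kernel

set_option maxHeartbeats 0 in
set_option maxRecDepth 100000 in
/-- The slice `(2, 3)` of the triple `(1, 2, 4)`. -/
theorem certS_a1a2b_23 : CertS La1a2b 2 3 := by
  unfold CertS
  decide +kernel

end Deg3

end Summit.Ventures.PercRepro2
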